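import Summits.BirchSwinnertonDyer.BirchSwinnertonDyer.Theorems.TwoAdicConverseOrdLambdaHalfAtTwoGreenbergTwistOrdinary
import Literature.NumberTheory.EllipticCurves.BSDSelmerPParityNoContinuationProofs
import Literature.NumberTheory.EllipticCurves.IwasawaCyclotomicProofs
import Literature.NumberTheory.DiophantineGeometry.Conductor
import Literature.NumberTheory.NumberFields.CongruenceSubgroupTorsionFree
import HarnessLib

/-!
# Route `TwoAdicConverse` (rung S3), crux `OrdLambdaHalfAtTwo` (item stmt-BirchSwinnertonDyer-19556), line
# `kato-determinant-greenberg-two`: the GREENBERG-FIELD PACKAGE — clauses (i), (ii), (iii) of the registered stub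
# `stub_greenbergSupplyAtTwo` assembled BY NAME, in the stub's binder order

Cell `bsd-2adic`, seat `bsd-2adic-conv-1` GEN 24 (`--supports` stmt-BirchSwinnertonDyer-19556; helper; route-independent
imports).  The registered stub 3 of the skeleton `Cruxes/OrdLambdaHalfAtTwo/Lines/kato_determinant_greenberg_two.lean`
(skeleton `037466d7c4ab`) asks, for a non-CM globally minimal `W/ℚ` good ordinary at `2` with a rational `2`-torsion point,
for: (i) an imaginary quadratic «Greenberg field» `K` with every prime of `2·N_E` split; (ii) every globally minimal model
of the twist `W^{(d_K)}` ordinary at `2`; (iii) a prime `w ∣ 2` of `K`, the cyclotomic `ℤ₂`-extension `κ_K` of `K` with a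
topological generator `γ_K`; (iv) Pontryagin duals `X_Gr`, `X_fine` of the Greenberg (strict at `w`, relaxed at `w̄`) and
fine Selmer groups over `K_∞`; (v) **`X_Gr` finitely generated and `Λ`-TORSION (B2)**.  This file delivers (i)–(iii) as
ONE existential statement in the stub's binder order (`greenbergFieldPackage`), from tree theorems only:
(i) `exists_isImaginaryQuadratic_satisfiesHeegnerHypothesis` (Dirichlet; file `BSDSelmerPParityNoContinuationProofs`),
(ii) `TwoAdicGreenbergTwist.isOrdinaryAt_two_twist_of_greenbergField` (p657030), (iii)
`NumberFields.RingOfIntegers.exists_heightOneSpectrum_natCast_mem` (a prime of `𝓞_K` above `2`) and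
`exists_cyclotomicZpExtension_holds` (Iwasawa 1959 / Washington §13.1: every number field has a cyclotomic
`ℤ_p`-extension; a topological generator by surjectivity of `κ`).  Clause (iv) is the Literature datum
`WeierstrassCurve.GreenbergStrictSelmerDualData` / `greenbergStrictSelmerDualData` (p656787, any Greenberg data `L`), so that
**stub 3 = (this package) ∧ (p656787) ∧ B2**: its only research content is the cotorsion clause (v).

HONEST FRAMING.  Existence bookkeeping; no Selmer group is computed, nothing about cotorsion/`μ`/`λ` is claimed; BSD is
not proved by any of this.  The habitat binders `¬ W.HasCM`, «rational `2`-torsion» of the stub are NOT needed for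
(i)–(iii) (only `GoodOrd W 2` enters, through (ii)); they are kept out of the signature on purpose.  PARTITION (D-0054):
none — RANK axis S3 × X5@2 stratum (β).

References: K. Iwasawa, Bull. AMS 65 (1959) [Iwasawa1959]; L. Washington, *Introduction to Cyclotomic Fields* §13.1
[Washington1997]; B. Gross, *Heegner points on `X₀(N)`* (1984) §3 [Gross1984].
-/

set_option linter.dupNamespace false
set_option autoImplicit false

namespace Summit.BirchSwinnertonDyer.BirchSwinnertonDyer.Theorems.TwoAdicGreenbergTwist

open WeierstrassCurve NumberField IsDedekindDomain Field Literature.NumberTheory.EllipticCurves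
  Literature.NumberTheory.EllipticCurves.Rank1Residual

/-- **A Greenberg field exists for every level**: for `N ≠ 0` there is an imaginary quadratic `K` with every prime of
`2N` split in `K` (Dirichlet's theorem; tree `exists_isImaginaryQuadratic_satisfiesHeegnerHypothesis`). [folklore] -/
theorem exists_greenbergField {N : ℕ} (hN : N ≠ 0) :
    ∃ (K : Type) (_ : Field K) (_ : NumberField K),
      IsImaginaryQuadratic K ∧ SatisfiesHeegnerHypothesis (2 * N) K := by
  obtain ⟨K, iF, iN, hK, -, hH⟩ :=
    exists_isImaginaryQuadratic_satisfiesHeegnerHypothesis (N := 2 * N) (mul_ne_zero two_ne_zero hN) 0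
  exact ⟨K, iF, iN, hK, hH⟩

/-- **The cyclotomic `ℤ₂`-tower data of a number field `K`**: a prime `w ∣ 2` of `𝓞_K`, a cyclotomic `ℤ₂`-extension
`κ_K` of `K` and a topological generator `γ_K` (Iwasawa 1959; Washington §13.1; tree `exists_cyclotomicZpExtension_holds`,
`RingOfIntegers.exists_heightOneSpectrum_natCast_mem`). [cite: Washington1997, §13.1 (p. 264)] -/
theorem exists_prime_two_cyclotomic_topGenerator (K : Type) [Field K] [NumberField K] :
    ∃ (w : HeightOneSpectrum (𝓞 K)) (_ : ((2 : ℕ) : 𝓞 K) ∈ w.asIdeal)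
      (κK : ZpExtension K 2) (γK : absoluteGaloisGroup K), κK.IsCyclotomic ∧ κK.IsTopGenerator γK := by
  obtain ⟨w, hw⟩ :=
    Literature.NumberTheory.NumberFields.RingOfIntegers.exists_heightOneSpectrum_natCast_mem K Nat.prime_two
  obtain ⟨κK, hκK⟩ := exists_cyclotomicZpExtension_holds K 2
  obtain ⟨γK, hγK⟩ := κK.surjective (Multiplicative.ofAdd 1)
  exact ⟨w, hw, κK, γK, hκK, hγK⟩

/-- **The Greenberg-field package (clauses (i)–(iii) of `stub_greenbergSupplyAtTwo`, in the stub's binder order).**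
For `W/ℚ` globally minimal with `GoodOrd W 2`: an imaginary quadratic `K` with the Heegner hypothesis for `2·N_E`
(`N_E = W.conductorNorm ℤ`), such that every globally minimal model `A` of `W^{(d_K)}` is `IsOrdinaryAt A 2`, together
with a prime `w ∣ 2` of `K`, a cyclotomic `ℤ₂`-extension `κ_K` of `K` and a topological generator `γ_K`.  What the stub
asks BEYOND this is the existence of the duals (Literature `WeierstrassCurve.greenbergStrictSelmerDualData`, any data `L`)
and the COTORSION of `X_Gr` (B2, research). [cite: Washington1997, §13.1 (p. 264)] [cite: Gross1984, §3] -/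
theorem greenbergFieldPackage (W : WeierstrassCurve ℚ) [W.IsElliptic] [W.IsGloballyMinimal] (hgo : GoodOrd W 2) :
    ∃ (K : Type) (_ : Field K) (_ : NumberField K),
      (IsImaginaryQuadratic K ∧ SatisfiesHeegnerHypothesis (2 * W.conductorNorm ℤ) K) ∧
      (∀ (A : WeierstrassCurve ℚ) [A.IsElliptic] [A.IsGloballyMinimal] (C : VariableChange ℚ),
          C • A = W.quadraticTwist ((NumberField.discr K : ℤ) : ℚ) → IsOrdinaryAt A 2) ∧
      ∃ (w : HeightOneSpectrum (𝓞 K)) (_ : ((2 : ℕ) : 𝓞 K) ∈ w.asIdeal)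
        (κK : ZpExtension K 2) (γK : absoluteGaloisGroup K), κK.IsCyclotomic ∧ κK.IsTopGenerator γK := by
  obtain ⟨K, iF, iN, hK⟩ := exists_greenbergField (N := W.conductorNorm ℤ) (W.conductorNorm_pos_holds).ne'
  obtain ⟨w, hw, κK, γK, hκK, hγK⟩ := exists_prime_two_cyclotomic_topGenerator K
  exact ⟨K, iF, iN, hK, isOrdinaryAt_two_twist_of_greenbergField W hgo hK, w, hw, κK, γK, hκK, hγK⟩

end Summit.BirchSwinnertonDyer.BirchSwinnertonDyer.Theorems.TwoAdicGreenbergTwist
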